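/-
Copyright (c) 2026 the pub-hodgecm-mathlib formalisation cell (harness21).  Prover seat hodgecm-mathlib-K2E5-p17 (g9) (L1 hand dealt to S4 by chair VALVE 12 (c)),
R90-TF §S4 — the (K-FIN) COVER ⇒ TRANSVERSAL step of the (B1) T-WIF assembly (S4 dealer K2E2-plan (g7) DEAL 2026-09-05T01:56Z).
THEOREMS ONLY (no `def`, no `instance`, no notation, no named-fact hypothesis, no `sorry`); NO `Lines` import.
-/
import Summits.HodgeConjecture.HodgeConjecture.Theorems.R90S4NormCosetsFinite          -- ★ p863945 (K-FIN) `exists_finset_normCosets`; brings ★ α `R90S4TwistedCartanNormFibres` (`epsNorm_mul_epsLoc_inv`), ★ `R90S4CartanNormMap` (`mul_comm_of_mem_centralizer_of_isRegularElt`, `epsLoc_mem_centralizer_coe`, `epsNorm_mul_of_mem_centralizer`)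
import Summits.HodgeConjecture.HodgeConjecture.Theorems.R90S4SplitFormHermitian        -- ★ `splitFormGL_isHermitian` (the form of record is hermitian)
import HarnessLib

/-!
# R90-TF §S4 — (K-FIN) ⇒ A FINITE TRANSVERSAL `R ⊆ T̃ᴺ` OF `K_T = T̃ᴺ ∕ (1−ε)T̃` (Rogawski 1990, §3.11 Prop. 3.11.1 (c) p. 34; §12.5 p. 186)

Cell `hodgecm-mathlib`, crux item h413 = `stmt-HodgeConjecture-24833` (helper lane `--supports … --as helper`, count-neutral); R90-TF squad S4 (dealer K2E2-plan (g7),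
DEAL 2026-09-05T01:56:21Z «NEXT FOR p17»); consumer = R90-C131-p03 (g3)'s (B1-T) PART 1 `R90S4TwistedTubeTransversal`, whose letters `(R)(hRN)(hRcov)(hRinj)` this file
DISCHARGES (binder bytes verbatim).

THE MATHEMATICS.  `γ₀ ∈ G_v = U(Φ)(L⁺_v)` regular, `T̃ = Cent_{G̃_v}(γ₀)` (abelian ★ `mul_comm_of_mem_centralizer_of_isRegularElt`, ε-stable ★ `epsLoc_mem_centralizer_coe`),
`N(δ) = δ ε(δ)`, `T̃ᴺ = Ker N`, `(1−ε)T̃ = {a ε(a)⁻¹ | a ∈ T̃} ⊆ T̃ᴺ` (★ `epsNorm_mul_epsLoc_inv`, hermitian `Φ`).  ★ (K-FIN) `exists_finset_normCosets` (non-split `v`) gives a finite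
`R₀ ⊆ G̃_v` with `T̃ᴺ ⊆ ⋃_{r ∈ R₀} r·(1−ε)T̃` — a COVER, with `r` neither in `T̃` nor of norm one a priori, and two `r`'s possibly in the same coset.  This file upgrades it to a
TRANSVERSAL: a finite `R ⊆ T̃` of norm-one elements meeting every `(1−ε)T̃`-coset of `T̃ᴺ` exactly once.
* §1 THE COSET RELATION `u ∼ w :↔ ∃ a ∈ T̃, w = u · a ε(a)⁻¹` on `T̃` is an EQUIVALENCE (`a := 1`; `a := a⁻¹`; `a := a b` — commutativity in `T̃`), and `∼` preserves `N = 1`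
  (`N` multiplicative on `T̃` ★ `epsNorm_mul_of_mem_centralizer`, `N(a ε(a)⁻¹) = 1`).
* §2 THE TRANSVERSAL **`exists_normTransversal_of_cover`**: for norm-one `w ∈ T̃` put `rep w := Classical.epsilon (P_w)`, `P_w u :↔ u ∈ R₀ ∧ u ∼ w`; `P_w` is satisfiable (the cover:
  `w = r · s ε(s)⁻¹` forces `r = w (s ε(s)⁻¹)⁻¹ ∈ T̃` and `r ∼ w`) and CLASS-INVARIANT (`w ∼ w′ ⇒ P_w = P_{w′}` by `funext`/`propext`), so `rep` is constant on cosets; `R :=` the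
  `rep w` (`w ∈ T̃ᴺ`) inside the finite `R₀ ∩ T̃` — `hRN` (§1: `rep w ∼ w`, `N w = 1`), `hRcov` (`w = rep w · a ε(a)⁻¹`), `hRinj` (`rep w ∼ rep w′ ⇒ w ∼ w′ ⇒ rep w = rep w′`).
  **`exists_normTransversal_of_cover_splitFormGL`** — the form of record `Φ₃ = splitFormGL L` (hermitian ★ `splitFormGL_isHermitian`), p03's carrier token for token.
HONEST LABEL.  Count-neutral helper: `HC_CM` is proved only modulo the 7 printed citations (2 remaining named inputs: hLiu418 = `stmt-HodgeConjecture-24832`,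
h413 = `stmt-HodgeConjecture-24833`) until rung 0 closes; (K-FIN) ⇒ transversal is one input of (B1) behind the OPEN (W-NP) — it pays no named input by itself.
-/

set_option autoImplicit false
set_option linter.dupNamespace false -- the mandated namespace repeats `HodgeConjecture.HodgeConjecture`

noncomputable section

open scoped NumberField Matrix MatrixGroups

namespace Summit.HodgeConjecture.HodgeConjecture.R90.S4

open Literature.NumberTheory.Rogawski1990 Literature.NumberTheory.Rogawski1990.Ch4Sec10
open Literature.NumberTheory.Automorphic Literature.NumberTheory.Automorphic.UnitaryGroup
open IsDedekindDomain NumberField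

variable {L : Type} [Field L] [NumberField L] [IsCMField L] {Φ : GL (Fin 3) L} {v : HeightOneSpectrum (𝓞 ↥(maximalRealSubfield L))}
  {γ₀ : (UnitaryGroup.cmDatum L 3 (Φ : Matrix (Fin 3) (Fin 3) L)).Local v}

/-! ## §1 The coset relation `u ∼ w :↔ w ∈ u·(1−ε)T̃` on `T̃ = Cent_{G̃_v}(γ₀)` is an equivalence and preserves `N = 1` -/

/-- `∼` is REFLEXIVE: `u = u · 1 ε(1)⁻¹`. [cite: Rogawski1990, §3.11 p. 34] -/
theorem epsCosetRel_refl (u : ↥(Subgroup.centralizer ({(γ₀.val : GtLoc L v)} : Set (GtLoc L v)))) :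
    ∃ a : ↥(Subgroup.centralizer ({(γ₀.val : GtLoc L v)} : Set (GtLoc L v))), (u : GtLoc L v) = u * (a * (epsLoc L Φ v a)⁻¹) :=
  ⟨1, by simp only [OneMemClass.coe_one, map_one, inv_one, mul_one]⟩

/-- `∼` is SYMMETRIC (`γ₀` regular, so `T̃` is abelian): `w = u · a ε(a)⁻¹ ⇒ u = w · a⁻¹ ε(a⁻¹)⁻¹`. [cite: Rogawski1990, §3.11 p. 34; §3.1 p. 19] -/
theorem epsCosetRel_symm (hγ₀ : IsRegularElt (γ₀.val : GtLoc L v))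
    {u w : ↥(Subgroup.centralizer ({(γ₀.val : GtLoc L v)} : Set (GtLoc L v)))}
    (h : ∃ a : ↥(Subgroup.centralizer ({(γ₀.val : GtLoc L v)} : Set (GtLoc L v))), (w : GtLoc L v) = u * (a * (epsLoc L Φ v a)⁻¹)) :
    ∃ a : ↥(Subgroup.centralizer ({(γ₀.val : GtLoc L v)} : Set (GtLoc L v))), (u : GtLoc L v) = w * (a * (epsLoc L Φ v a)⁻¹) := by
  obtain ⟨a, ha⟩ := h
  -- `a` and `ε(a)` commute (both lie in the abelian `T̃`)
  have hc : (a : GtLoc L v) * epsLoc L Φ v a = epsLoc L Φ v a * a :=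
    mul_comm_of_mem_centralizer_of_isRegularElt hγ₀ a.2 (epsLoc_mem_centralizer_coe γ₀ a.2)
  have hc' : (epsLoc L Φ v a)⁻¹ * (a : GtLoc L v)⁻¹ = (a : GtLoc L v)⁻¹ * (epsLoc L Φ v a)⁻¹ := by
    rw [← mul_inv_rev, ← mul_inv_rev, hc]
  refine ⟨a⁻¹, ?_⟩
  rw [InvMemClass.coe_inv, map_inv, inv_inv, ha]
  calc (u : GtLoc L v) = u * ((a : GtLoc L v) * ((a : GtLoc L v)⁻¹ * (epsLoc L Φ v a)⁻¹) * epsLoc L Φ v a) := by group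
    _ = u * ((a : GtLoc L v) * ((epsLoc L Φ v a)⁻¹ * (a : GtLoc L v)⁻¹) * epsLoc L Φ v a) := by rw [hc']
    _ = u * (a * (epsLoc L Φ v a)⁻¹) * ((a : GtLoc L v)⁻¹ * epsLoc L Φ v a) := by group

/-- `∼` is TRANSITIVE (`γ₀` regular): `w = u · a ε(a)⁻¹`, `x = w · b ε(b)⁻¹ ⇒ x = u · (ab) ε(ab)⁻¹`. [cite: Rogawski1990, §3.11 p. 34; §3.1 p. 19] -/
theorem epsCosetRel_trans (hγ₀ : IsRegularElt (γ₀.val : GtLoc L v))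
    {u w x : ↥(Subgroup.centralizer ({(γ₀.val : GtLoc L v)} : Set (GtLoc L v)))}
    (h₁ : ∃ a : ↥(Subgroup.centralizer ({(γ₀.val : GtLoc L v)} : Set (GtLoc L v))), (w : GtLoc L v) = u * (a * (epsLoc L Φ v a)⁻¹))
    (h₂ : ∃ b : ↥(Subgroup.centralizer ({(γ₀.val : GtLoc L v)} : Set (GtLoc L v))), (x : GtLoc L v) = w * (b * (epsLoc L Φ v b)⁻¹)) :
    ∃ c : ↥(Subgroup.centralizer ({(γ₀.val : GtLoc L v)} : Set (GtLoc L v))), (x : GtLoc L v) = u * (c * (epsLoc L Φ v c)⁻¹) := by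
  obtain ⟨a, ha⟩ := h₁
  obtain ⟨b, hb⟩ := h₂
  have hbm : (b : GtLoc L v) * (epsLoc L Φ v b)⁻¹ ∈ Subgroup.centralizer ({(γ₀.val : GtLoc L v)} : Set (GtLoc L v)) :=
    Subgroup.mul_mem _ b.2 (Subgroup.inv_mem _ (epsLoc_mem_centralizer_coe γ₀ b.2))
  -- `ε(a)⁻¹` and `b ε(b)⁻¹` commute (both lie in the abelian `T̃`)
  have hc : (epsLoc L Φ v a)⁻¹ * ((b : GtLoc L v) * (epsLoc L Φ v b)⁻¹) = (b : GtLoc L v) * (epsLoc L Φ v b)⁻¹ * (epsLoc L Φ v a)⁻¹ :=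
    mul_comm_of_mem_centralizer_of_isRegularElt hγ₀ (Subgroup.inv_mem _ (epsLoc_mem_centralizer_coe γ₀ a.2)) hbm
  refine ⟨a * b, ?_⟩
  rw [hb, ha, Subgroup.coe_mul, map_mul, mul_inv_rev]
  calc (u : GtLoc L v) * (a * (epsLoc L Φ v a)⁻¹) * (b * (epsLoc L Φ v b)⁻¹)
      = u * (a * ((epsLoc L Φ v a)⁻¹ * ((b : GtLoc L v) * (epsLoc L Φ v b)⁻¹))) := by simp only [mul_assoc]
    _ = u * (a * ((b : GtLoc L v) * (epsLoc L Φ v b)⁻¹ * (epsLoc L Φ v a)⁻¹)) := by rw [hc]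
    _ = u * (a * b * ((epsLoc L Φ v b)⁻¹ * (epsLoc L Φ v a)⁻¹)) := by simp only [mul_assoc]

/-- `∼` PRESERVES `N = 1` (hermitian `Φ`, `γ₀` regular): if `w = u · a ε(a)⁻¹` and `N w = 1` then `N u = 1` (`N` multiplicative on `T̃` ★ `epsNorm_mul_of_mem_centralizer`,
`N(a ε(a)⁻¹) = 1` ★ `epsNorm_mul_epsLoc_inv`). [cite: Rogawski1990, §3.11 p. 34; §12.5 p. 186] -/
theorem epsNorm_eq_one_of_epsCosetRel
    (hΦ : ((Φ : GL (Fin 3) L) : Matrix (Fin 3) (Fin 3) L)ᵀ.map (IsCMField.complexConj L) = (Φ : Matrix (Fin 3) (Fin 3) L))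
    (hγ₀ : IsRegularElt (γ₀.val : GtLoc L v))
    {u w : ↥(Subgroup.centralizer ({(γ₀.val : GtLoc L v)} : Set (GtLoc L v)))}
    (h : ∃ a : ↥(Subgroup.centralizer ({(γ₀.val : GtLoc L v)} : Set (GtLoc L v))), (w : GtLoc L v) = u * (a * (epsLoc L Φ v a)⁻¹))
    (hw : epsNorm (epsLoc L Φ v) (w : GtLoc L v) = 1) : epsNorm (epsLoc L Φ v) (u : GtLoc L v) = 1 := by
  obtain ⟨a, ha⟩ := h
  have ham : (a : GtLoc L v) * (epsLoc L Φ v a)⁻¹ ∈ Subgroup.centralizer ({(γ₀.val : GtLoc L v)} : Set (GtLoc L v)) :=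
    Subgroup.mul_mem _ a.2 (Subgroup.inv_mem _ (epsLoc_mem_centralizer_coe γ₀ a.2))
  have hmul := epsNorm_mul_of_mem_centralizer hγ₀ u.2 ham
  rw [← ha, epsNorm_mul_epsLoc_inv hΦ, mul_one] at hmul
  rw [← hmul]
  exact hw

/-! ## §2 The transversal -/

/-- **(K-FIN) COVER ⇒ TRANSVERSAL.**  `v` non-split, `Φ` hermitian, `γ₀ ∈ G_v` regular, `T̃ = Cent_{G̃_v}(γ₀)`, `N = epsNorm ε`: there is a finite `R ⊆ T̃` with
(`hRN`) `N u = 1` for `u ∈ R`; (`hRcov`) every `w ∈ T̃` with `N w = 1` is `u · a ε(a)⁻¹` for some `u ∈ R`, `a ∈ T̃`; (`hRinj`) two elements of `R` in the same `(1−ε)T̃`-coset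
are equal — i.e. `R` is a set of representatives of `K_T = T̃ᴺ ∕ (1−ε)T̃` (finite: print Prop. 3.11.1 (c), `K_T ≅ H¹(F,T)`).  From the ★ cover `exists_finset_normCosets` by one
`Classical.epsilon` per coset (§2 of the module docstring); the three conjuncts are the binders `(hRN)(hRcov)(hRinj)` of ★ `R90S4TwistedTubeTransversal` byte for byte.
[cite: Rogawski1990, §3.11 Prop. 3.11.1 (c) p. 34; §3.5 Prop. 3.5.2 p. 25; §12.5 p. 186] -/
theorem exists_normTransversal_of_cover (hns : ∀ w : PlacesOver L v, IsCMField.complexConj L • w.1 = w.1)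
    (hΦ : ((Φ : GL (Fin 3) L) : Matrix (Fin 3) (Fin 3) L)ᵀ.map (IsCMField.complexConj L) = (Φ : Matrix (Fin 3) (Fin 3) L))
    (hγ₀ : IsRegularElt (γ₀.val : GtLoc L v)) :
    ∃ R : Finset ↥(Subgroup.centralizer ({(γ₀.val : GtLoc L v)} : Set (GtLoc L v))),
      (∀ u ∈ R, epsNorm (epsLoc L Φ v) (u : GtLoc L v) = 1) ∧
      (∀ w : ↥(Subgroup.centralizer ({(γ₀.val : GtLoc L v)} : Set (GtLoc L v))), epsNorm (epsLoc L Φ v) (w : GtLoc L v) = 1 →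
        ∃ u ∈ R, ∃ a : ↥(Subgroup.centralizer ({(γ₀.val : GtLoc L v)} : Set (GtLoc L v))),
          (w : GtLoc L v) = u * (a * (epsLoc L Φ v a)⁻¹)) ∧
      (∀ u ∈ R, ∀ u' ∈ R, (∃ a : ↥(Subgroup.centralizer ({(γ₀.val : GtLoc L v)} : Set (GtLoc L v))),
          ((u' : ↥(Subgroup.centralizer ({(γ₀.val : GtLoc L v)} : Set (GtLoc L v)))) : GtLoc L v) = u * (a * (epsLoc L Φ v a)⁻¹)) → u = u') := by
  classical
  obtain ⟨R₀, hR₀⟩ := exists_finset_normCosets hns hγ₀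
  set Tt : Subgroup (GtLoc L v) := Subgroup.centralizer ({(γ₀.val : GtLoc L v)} : Set (GtLoc L v)) with hTt
  -- the coset relation and its equivalence properties (§1)
  let rel : ↥Tt → ↥Tt → Prop := fun u w => ∃ a : ↥Tt, (w : GtLoc L v) = u * (a * (epsLoc L Φ v a)⁻¹)
  have hsymm : ∀ {u w : ↥Tt}, rel u w → rel w u := fun h => epsCosetRel_symm hγ₀ h
  have htrans : ∀ {u w x : ↥Tt}, rel u w → rel w x → rel u x := fun h₁ h₂ => epsCosetRel_trans hγ₀ h₁ h₂
  -- the class-invariant predicate `P w u :↔ u ∈ R₀ ∧ u ∼ w` and the representative `rep w := ε-choice of P w`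
  let P : ↥Tt → ↥Tt → Prop := fun w u => (u : GtLoc L v) ∈ R₀ ∧ rel u w
  have hP : ∀ {w w' : ↥Tt}, rel w w' → P w = P w' := by
    intro w w' h
    funext u
    exact propext ⟨fun hu => ⟨hu.1, htrans hu.2 h⟩, fun hu => ⟨hu.1, htrans hu.2 (hsymm h)⟩⟩
  let rep : ↥Tt → ↥Tt := fun w => Classical.epsilon (P w)
  -- every norm-one `w ∈ T̃` has a `P w`-witness (the ★ cover: `w = r · s ε(s)⁻¹` forces `r ∈ T̃` and `r ∼ w`), hence `rep w` satisfies `P w`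
  have hPex : ∀ w : ↥Tt, epsNorm (epsLoc L Φ v) (w : GtLoc L v) = 1 → ∃ u, P w u := by
    intro w hw
    obtain ⟨r, hr, s, hs, hw'⟩ := hR₀ w w.2 hw
    have hsm : s * (epsLoc L Φ v s)⁻¹ ∈ Tt := Subgroup.mul_mem _ hs (Subgroup.inv_mem _ (epsLoc_mem_centralizer_coe γ₀ hs))
    have hrT : r ∈ Tt := by
      have hr' : r = (w : GtLoc L v) * (s * (epsLoc L Φ v s)⁻¹)⁻¹ := by rw [hw', mul_inv_cancel_right]
      rw [hr']
      exact Subgroup.mul_mem _ w.2 (Subgroup.inv_mem _ hsm)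
    exact ⟨⟨r, hrT⟩, hr, ⟨s, hs⟩, hw'⟩
  have hrep : ∀ w : ↥Tt, epsNorm (epsLoc L Φ v) (w : GtLoc L v) = 1 → P w (rep w) := fun w hw => Classical.epsilon_spec (hPex w hw)
  -- the transversal: the representatives of norm-one elements, inside the finite `R₀ ∩ T̃`
  refine ⟨(R₀.subtype (· ∈ Tt)).filter (fun u => ∃ w : ↥Tt, epsNorm (epsLoc L Φ v) (w : GtLoc L v) = 1 ∧ rep w = u), ?_, ?_, ?_⟩
  · -- (hRN) `rep w ∼ w` and `N w = 1` give `N (rep w) = 1`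
    intro u hu
    obtain ⟨-, w, hw, hwu⟩ := Finset.mem_filter.1 hu
    rw [← hwu]
    exact epsNorm_eq_one_of_epsCosetRel hΦ hγ₀ (hrep w hw).2 hw
  · -- (hRcov) `w = rep w · a ε(a)⁻¹`
    intro w hw
    exact ⟨rep w, Finset.mem_filter.2 ⟨Finset.mem_subtype.2 (hrep w hw).1, w, hw, rfl⟩, (hrep w hw).2⟩
  · -- (hRinj) `rep w ∼ rep w′ ⇒ w ∼ w′ ⇒ P w = P w′ ⇒ rep w = rep w′`
    intro u hu u' hu' h
    obtain ⟨-, w, hw, hwu⟩ := Finset.mem_filter.1 hu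
    obtain ⟨-, w', hw', hwu'⟩ := Finset.mem_filter.1 hu'
    have h₁ : rel (rep w) w := (hrep w hw).2
    have h₂ : rel (rep w') w' := (hrep w' hw').2
    rw [hwu] at h₁
    rw [hwu'] at h₂
    have hww' : rel w w' := htrans (htrans (hsymm h₁) h) h₂
    have hrr : rep w = rep w' := by
      show Classical.epsilon (P w) = Classical.epsilon (P w')
      rw [hP hww']
    rw [← hwu, ← hwu', hrr]

/-- **(K-FIN) COVER ⇒ TRANSVERSAL AT THE FORM OF RECORD `Φ₃ = splitFormGL L`** (hermitian ★ `splitFormGL_isHermitian`): the letters `(R)(hRN)(hRcov)(hRinj)` of ★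
`R90S4TwistedTubeTransversal` on its carrier `(UnitaryGroup.cmDatum L 3 (splitFormGL L : Matrix (Fin 3) (Fin 3) L)).Local v`, token for token.
[cite: Rogawski1990, §3.11 Prop. 3.11.1 (c) p. 34; §12.5 p. 186] -/
theorem exists_normTransversal_of_cover_splitFormGL (hns : ∀ w : PlacesOver L v, IsCMField.complexConj L • w.1 = w.1)
    {γ₀ : (UnitaryGroup.cmDatum L 3 (splitFormGL L : Matrix (Fin 3) (Fin 3) L)).Local v} (hγ₀ : IsRegularElt (γ₀.val : GtLoc L v)) :
    ∃ R : Finset ↥(Subgroup.centralizer ({(γ₀.val : GtLoc L v)} : Set (GtLoc L v))),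
      (∀ u ∈ R, epsNorm (epsLoc L (splitFormGL L) v) (u : GtLoc L v) = 1) ∧
      (∀ w : ↥(Subgroup.centralizer ({(γ₀.val : GtLoc L v)} : Set (GtLoc L v))), epsNorm (epsLoc L (splitFormGL L) v) (w : GtLoc L v) = 1 →
        ∃ u ∈ R, ∃ a : ↥(Subgroup.centralizer ({(γ₀.val : GtLoc L v)} : Set (GtLoc L v))),
          (w : GtLoc L v) = u * (a * (epsLoc L (splitFormGL L) v a)⁻¹)) ∧
      (∀ u ∈ R, ∀ u' ∈ R, (∃ a : ↥(Subgroup.centralizer ({(γ₀.val : GtLoc L v)} : Set (GtLoc L v))),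
          ((u' : ↥(Subgroup.centralizer ({(γ₀.val : GtLoc L v)} : Set (GtLoc L v)))) : GtLoc L v) = u * (a * (epsLoc L (splitFormGL L) v a)⁻¹)) → u = u') :=
  exists_normTransversal_of_cover hns (splitFormGL_isHermitian L) hγ₀

end Summit.HodgeConjecture.HodgeConjecture.R90.S4

end
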